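import Mathlib

/-!
# Components of the Zariski closure of a set of points; infinite sets have a positive-dimensional component

Standard facts about the Zariski closure `Z_K(I_k(S))` of a set of points `S ⊆ K^ι` over a
coefficient field `k ⊆ K` (`ι` finite), phrased through `MvPolynomial.vanishingIdeal` /
`MvPolynomial.zeroLocus` and the minimal primes of the radical ideal `I_k(S)`
(Hartshorne, *Algebraic Geometry*, I.1: every closed set is the finite union of its irreducible
components `Z(𝔭)`, `𝔭` minimal over its ideal, Prop. 1.5 / Cor. 1.6; a zero-dimensional
component is a finite set of points):

* `isRadical_vanishingIdeal` — `I_k(S)` is a radical ideal;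
* `subset_iUnion_zeroLocus_minimalPrimes` — `S ⊆ ⋃_{𝔭 minimal over I_k(S)} Z_K(𝔭)`
  (the components cover the closed set);
* `vanishingIdeal_inter_zeroLocus_of_mem_minimalPrimes` — **`S` is dense in every component of
  its closure**: `I_k(S ∩ Z_K(𝔭)) = 𝔭` for every minimal prime `𝔭` of `I_k(S)` (irredundance of
  the decomposition into components);
* `zeroLocus_finite_of_isMaximal` — the `K`-zero set of a maximal ideal of `k[X_ι]` is finite
  (each variable is algebraic modulo a maximal ideal, Zariski's lemma);
* `exists_mem_minimalPrimes_inter_infinite` — **an infinite `S` meets some component `Z_K(𝔭)` in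
  an infinite set, dense in `Z_K(𝔭)`, and that component is positive-dimensional**:
  `¬ 𝔭.IsMaximal` and `1 ≤ dim k[X_ι] ⧸ 𝔭`.

Typical use: `S ⊆ ℤⁿ ⊆ ℚⁿ ⊆ ℂⁿ` an infinite set of lattice points; then some irreducible component
(over the chosen coefficient field) of its Zariski closure is a positive-dimensional variety in
which the lattice points of `S` are Zariski dense.

## References

* [Hartshorne1977] R. Hartshorne, *Algebraic Geometry*, Springer GTM 52 (1977), Ch. I §1,
  Prop. 1.5, Cor. 1.6.
* [AtiyahMacdonald1969] M. Atiyah, I. Macdonald, *Introduction to Commutative Algebra* (1969),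
  Prop. 1.11 (prime avoidance / primes containing a product), Prop. 7.9 and Cor. 5.24 (Zariski's
  lemma: a finitely generated algebra over a field that is a field is a finite extension).
-/

noncomputable section

open MvPolynomial

namespace Literature.RingTheory.KrullDimension

variable {k K : Type*} [Field k] [Field K] [Algebra k K] {ι : Type*}

/-! ### The components of the closure of a set of points -/

omit [Algebra k K] in
/-- The vanishing ideal `I_k(S)` of a set of points is radical: `f ^ n` vanishes on `S` only if
`f` does. [folklore] -/
theorem isRadical_vanishingIdeal [Algebra k K] (S : Set (ι → K)) :
    (vanishingIdeal k S : Ideal (MvPolynomial ι k)).IsRadical := by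
  intro f hf
  rcases (Ideal.mem_radical_iff.1 hf) with ⟨n, hn⟩
  rw [mem_vanishingIdeal_iff] at hn ⊢
  intro x hx
  have h := hn x hx
  rw [map_pow] at h
  exact pow_eq_zero_iff'.1 h |>.1

/-- **The components cover the closure**: every point of `S` lies in `Z_K(𝔭)` for some minimal
prime `𝔭` of `I_k(S)`. (Otherwise pick, for each of the finitely many minimal primes, a member not
vanishing at the point; their product lies in `⋂ 𝔭 = √I_k(S) = I_k(S)` yet does not vanish at a
point of `S`.) [cite: Hartshorne1977, I Prop. 1.5 and Cor. 1.6] -/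
theorem subset_iUnion_zeroLocus_minimalPrimes [Finite ι] (S : Set (ι → K)) :
    S ⊆ ⋃ 𝔭 ∈ (vanishingIdeal k S : Ideal (MvPolynomial ι k)).minimalPrimes, zeroLocus K 𝔭 := by
  classical
  intro x hx
  by_contra h
  simp only [Set.mem_iUnion, not_exists] at h
  have hfin := Ideal.finite_minimalPrimes_of_isNoetherianRing (MvPolynomial ι k)
    (vanishingIdeal k S : Ideal (MvPolynomial ι k))
  have key : ∀ 𝔭 ∈ (vanishingIdeal k S : Ideal (MvPolynomial ι k)).minimalPrimes,
      ∃ f ∈ 𝔭, aeval x f ≠ 0 := by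
    intro 𝔭 h𝔭
    by_contra h'
    push Not at h'
    exact h 𝔭 h𝔭 (mem_zeroLocus_iff.2 fun f hf => h' f hf)
  choose! f hf hfx using key
  set F : MvPolynomial ι k := ∏ 𝔭 ∈ hfin.toFinset, f 𝔭 with hF
  have hFrad : F ∈ (vanishingIdeal k S : Ideal (MvPolynomial ι k)).radical := by
    rw [← Ideal.sInf_minimalPrimes, Submodule.mem_sInf]
    intro 𝔭 h𝔭
    obtain ⟨c, hc⟩ := Finset.dvd_prod_of_mem f (hfin.mem_toFinset.2 h𝔭)
    rw [hF, hc]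
    exact Ideal.mul_mem_right c 𝔭 (hf 𝔭 h𝔭)
  have hFS : F ∈ vanishingIdeal k S := isRadical_vanishingIdeal S hFrad
  have h0 : aeval x F = 0 := (mem_vanishingIdeal_iff.1 hFS) x hx
  rw [hF, map_prod] at h0
  obtain ⟨𝔭, h𝔭, h𝔭0⟩ := Finset.prod_eq_zero_iff.1 h0
  exact hfx 𝔭 (hfin.mem_toFinset.1 h𝔭) h𝔭0

/-- **A set of points is Zariski dense in each component of its closure**: for every minimal prime
`𝔭` of `I_k(S)`, `I_k(S ∩ Z_K(𝔭)) = 𝔭`. (The ideals `J_𝔮 = I_k(S ∩ Z_K(𝔮))`, `𝔮` minimal, satisfy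
`⋂ J_𝔮 = I_k(S) ⊆ 𝔭`, so `J_𝔮 ⊆ 𝔭` for some `𝔮`; as `𝔮 ⊆ J_𝔮`, minimality forces `𝔮 = 𝔭`.)
[cite: Hartshorne1977, I Cor. 1.6] -/
theorem vanishingIdeal_inter_zeroLocus_of_mem_minimalPrimes [Finite ι] (S : Set (ι → K))
    {𝔭 : Ideal (MvPolynomial ι k)}
    (h𝔭 : 𝔭 ∈ (vanishingIdeal k S : Ideal (MvPolynomial ι k)).minimalPrimes) :
    vanishingIdeal k (S ∩ zeroLocus K 𝔭) = 𝔭 := by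
  classical
  have hfin := Ideal.finite_minimalPrimes_of_isNoetherianRing (MvPolynomial ι k)
    (vanishingIdeal k S : Ideal (MvPolynomial ι k))
  set J : Ideal (MvPolynomial ι k) → Ideal (MvPolynomial ι k) :=
    fun 𝔮 => vanishingIdeal k (S ∩ zeroLocus K 𝔮) with hJ
  -- `𝔮 ⊆ J_𝔮`
  have hle : ∀ 𝔮 : Ideal (MvPolynomial ι k), 𝔮 ≤ J 𝔮 := fun 𝔮 =>
    (le_vanishingIdeal_zeroLocus 𝔮).trans (vanishingIdeal_anti_mono Set.inter_subset_right)
  -- `⋂ J_𝔮 ⊆ I_k(S) ⊆ 𝔭`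
  have hinf : hfin.toFinset.inf J ≤ 𝔭 := by
    refine le_trans ?_ h𝔭.1.2
    intro g hg
    rw [mem_vanishingIdeal_iff]
    intro x hx
    obtain ⟨𝔮, h𝔮⟩ := Set.mem_iUnion.1 (subset_iUnion_zeroLocus_minimalPrimes (k := k) S hx)
    obtain ⟨h𝔮, hx𝔮⟩ := Set.mem_iUnion.1 h𝔮
    have hg' : g ∈ J 𝔮 := (Finset.inf_le (hfin.mem_toFinset.2 h𝔮) : hfin.toFinset.inf J ≤ J 𝔮) hg
    exact (mem_vanishingIdeal_iff.1 hg') x ⟨hx, hx𝔮⟩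
  obtain ⟨𝔮, h𝔮M, h𝔮𝔭⟩ := (Ideal.IsPrime.inf_le' h𝔭.1.1).1 hinf
  have h𝔮 := hfin.mem_toFinset.1 h𝔮M
  -- minimality: `𝔮 ⊆ J_𝔮 ⊆ 𝔭` forces `𝔮 = 𝔭`
  have h𝔮le : 𝔮 ≤ 𝔭 := (hle 𝔮).trans h𝔮𝔭
  have heq : 𝔮 = 𝔭 := le_antisymm h𝔮le (h𝔭.2 ⟨h𝔮.1.1, h𝔮.1.2⟩ h𝔮le)
  subst heq
  exact le_antisymm h𝔮𝔭 (hle 𝔮)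

/-! ### Zero-dimensional components are finite -/

/-- Modulo a maximal ideal of `k[X_ι]` (`ι` finite) every variable satisfies a monic polynomial
over `k` (Zariski's lemma: `k[X_ι] ⧸ 𝔪` is a finite extension of `k`). [cite: AtiyahMacdonald1969, Cor. 5.24] -/
theorem exists_monic_aeval_X_mem_of_isMaximal [Finite ι] (𝔪 : Ideal (MvPolynomial ι k))
    [h𝔪 : 𝔪.IsMaximal] (i : ι) :
    ∃ p : Polynomial k, p.Monic ∧ Polynomial.aeval (X i : MvPolynomial ι k) p ∈ 𝔪 := by
  letI : Field (MvPolynomial ι k ⧸ 𝔪) := Ideal.Quotient.field 𝔪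
  have hint : ((Ideal.Quotient.mk 𝔪).comp (C : k →+* MvPolynomial ι k)).IsIntegral :=
    MvPolynomial.comp_C_integral_of_surjective_of_isJacobsonRing _ Ideal.Quotient.mk_surjective
  obtain ⟨p, hp, hp0⟩ := hint (Ideal.Quotient.mk 𝔪 (X i))
  refine ⟨p, hp, ?_⟩
  rw [← Ideal.Quotient.eq_zero_iff_mem]
  have h : Ideal.Quotient.mk 𝔪 (Polynomial.aeval (X i : MvPolynomial ι k) p) =
      Polynomial.eval₂ ((Ideal.Quotient.mk 𝔪).comp C) (Ideal.Quotient.mk 𝔪 (X i)) p := by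
    rw [Polynomial.aeval_def, Polynomial.hom_eval₂]
    rfl
  rw [h, hp0]

/-- **The zero set of a maximal ideal is finite**: for a maximal ideal `𝔪 ⊆ k[X_ι]` (`ι` finite)
and any extension field `K`, `Z_K(𝔪)` is finite — each coordinate of a zero is a root of the monic
polynomial of `exists_monic_aeval_X_mem_of_isMaximal`. [cite: AtiyahMacdonald1969, Prop. 7.9 and Cor. 5.24] -/
theorem zeroLocus_finite_of_isMaximal [Finite ι] (𝔪 : Ideal (MvPolynomial ι k))
    [h𝔪 : 𝔪.IsMaximal] : (zeroLocus K 𝔪).Finite := by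
  classical
  cases nonempty_fintype ι
  choose p hpm hp𝔪 using exists_monic_aeval_X_mem_of_isMaximal (k := k) 𝔪
  -- every zero has coordinates among the roots of the `p i`
  have hsub : zeroLocus K 𝔪 ⊆
      {x : ι → K | ∀ i, x i ∈ (((p i).map (algebraMap k K)).roots.toFinset : Set K)} := by
    intro x hx i
    have hx' := (mem_zeroLocus_iff.1 hx) _ (hp𝔪 i)
    have hev : aeval x (Polynomial.aeval (X i : MvPolynomial ι k) (p i)) =
        ((p i).map (algebraMap k K)).eval (x i) := by
      rw [← Polynomial.aeval_algHom_apply, MvPolynomial.aeval_X, Polynomial.aeval_def,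
        Polynomial.eval_map]
    rw [hev] at hx'
    have hne : (p i).map (algebraMap k K) ≠ 0 := ((hpm i).map (algebraMap k K)).ne_zero
    simp only [Multiset.mem_toFinset, Finset.mem_coe]
    exact (Polynomial.mem_roots hne).2 hx'
  exact Set.Finite.subset (Set.Finite.pi' fun i => Finset.finite_toSet _) hsub

omit [Algebra k K] in
/-- A prime ideal of `k[X_ι]` that is not maximal has a quotient of Krull dimension `≥ 1`
(it lies strictly below a maximal ideal). [folklore] -/
theorem one_le_ringKrullDim_quotient_of_not_isMaximal (𝔭 : Ideal (MvPolynomial ι k))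
    [h𝔭 : 𝔭.IsPrime] (hmax : ¬ 𝔭.IsMaximal) :
    1 ≤ ringKrullDim (MvPolynomial ι k ⧸ 𝔭) := by
  obtain ⟨𝔪, h𝔪, h𝔭𝔪⟩ := Ideal.exists_le_maximal 𝔭 h𝔭.ne_top
  have hlt : 𝔭 < 𝔪 := lt_of_le_of_ne h𝔭𝔪 fun h => hmax (h ▸ h𝔪)
  rw [ringKrullDim_quotient, Order.one_le_krullDim_iff]
  refine ⟨⟨⟨𝔭, h𝔭⟩, le_refl 𝔭⟩, ⟨⟨𝔪, h𝔪.isPrime⟩, h𝔭𝔪⟩, ?_⟩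
  exact hlt

/-! ### Infinite sets of points -/

/-- **An infinite set of points meets some component of its Zariski closure in an infinite set**:
if `S ⊆ K^ι` is infinite (`ι` finite), some minimal prime `𝔭` of `I_k(S)` has `S ∩ Z_K(𝔭)`
infinite (the finitely many components cover `S`). [folklore] -/
theorem exists_mem_minimalPrimes_inter_infinite' [Finite ι] {S : Set (ι → K)} (hS : S.Infinite) :
    ∃ 𝔭 ∈ (vanishingIdeal k S : Ideal (MvPolynomial ι k)).minimalPrimes,
      (S ∩ zeroLocus K 𝔭).Infinite := by
  by_contra h
  push Not at h
  have hfin := Ideal.finite_minimalPrimes_of_isNoetherianRing (MvPolynomial ι k)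
    (vanishingIdeal k S : Ideal (MvPolynomial ι k))
  apply hS
  have hcov : S = ⋃ 𝔭 ∈ (vanishingIdeal k S : Ideal (MvPolynomial ι k)).minimalPrimes,
      (S ∩ zeroLocus K 𝔭) := by
    apply Set.Subset.antisymm
    · intro x hx
      obtain ⟨𝔭, h𝔭⟩ := Set.mem_iUnion.1 (subset_iUnion_zeroLocus_minimalPrimes (k := k) S hx)
      obtain ⟨h𝔭, hx𝔭⟩ := Set.mem_iUnion.1 h𝔭
      exact Set.mem_iUnion₂.2 ⟨𝔭, h𝔭, hx, hx𝔭⟩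
    · exact Set.iUnion₂_subset fun 𝔭 _ => Set.inter_subset_left
  rw [hcov]
  exact Set.Finite.biUnion hfin fun 𝔭 h𝔭 => h 𝔭 h𝔭

/-- **Zariski closure of an infinite set of points has a positive-dimensional component in which
the points are dense.** If `S ⊆ K^ι` is infinite (`ι` finite, `k ⊆ K` fields), there is a minimal
prime `𝔭` of `I_k(S) ⊆ k[X_ι]` such that `S ∩ Z_K(𝔭)` is infinite, `I_k(S ∩ Z_K(𝔭)) = 𝔭` (the
points of `S` on the component `Z_K(𝔭)` are Zariski dense in it), `𝔭` is not maximal and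
`dim k[X_ι] ⧸ 𝔭 ≥ 1` (folklore consequence of the decomposition into components,
Hartshorne I Prop. 1.5 / Cor. 1.6, and of Zariski's lemma). [folklore] -/
theorem exists_mem_minimalPrimes_inter_infinite [Finite ι] {S : Set (ι → K)} (hS : S.Infinite) :
    ∃ 𝔭 ∈ (vanishingIdeal k S : Ideal (MvPolynomial ι k)).minimalPrimes,
      (S ∩ zeroLocus K 𝔭).Infinite ∧ vanishingIdeal k (S ∩ zeroLocus K 𝔭) = 𝔭 ∧
      ¬ 𝔭.IsMaximal ∧ 1 ≤ ringKrullDim (MvPolynomial ι k ⧸ 𝔭) := by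
  obtain ⟨𝔭, h𝔭, hinf⟩ := exists_mem_minimalPrimes_inter_infinite' (k := k) hS
  haveI : 𝔭.IsPrime := h𝔭.1.1
  have hmax : ¬ 𝔭.IsMaximal := by
    intro h
    exact hinf ((zeroLocus_finite_of_isMaximal (K := K) 𝔭).subset Set.inter_subset_right)
  exact ⟨𝔭, h𝔭, hinf, vanishingIdeal_inter_zeroLocus_of_mem_minimalPrimes S h𝔭, hmax,
    one_le_ringKrullDim_quotient_of_not_isMaximal 𝔭 hmax⟩

end Literature.RingTheory.KrullDimension

end
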